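import Summits.QuantumAdvantage.QuantumAdvantage.Theorems.CharDialPartyDialA

/-!
# PartyDial (decomp-qadv lens-5 g35), part B1 — §1a: blocks, locality, independence count, one derandomisation step

See part A (`CharDialPartyDialA`) for the node header; memo `NODE-g35.md` (g35 folder of decomp-qadv-lens-5).
-/

set_option autoImplicit false
set_option linter.dupNamespace false

namespace Summit.QuantumAdvantage.QuantumAdvantage.Theorems.PartyDial

open Finset
open Summit.QuantumAdvantage.AdviceFreeQNC0

/-! ## §1  Blocks, locality, the independence count and derandomisation (the bridge)

Blocks are given by a block map `bl : Fin n → ℕ` (block `j` = `bl⁻¹(j)`), exactly as in the tree's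
`SumCodeZero` (`ovr bl j u a` = `u` with its block-`j` bits replaced by those of `a`; `bw bl j u` = the
Hamming weight of block `j`; `sum_card_filter_ovr` = the block-swap double count). -/

section Bridge

variable {n : ℕ} (bl : Fin n → ℕ)

/-- `f` READS ONLY BLOCK `j`: it is determined by the block-`j` bits. -/
def BlockLocal {β : Sort*} (j : ℕ) (f : (Fin n → Bool) → β) : Prop :=
  ∀ u v : Fin n → Bool, (∀ i, bl i = j → u i = v i) → f u = f v

/-- the CLASS of block `j` at `u`: its weight mod `3`. -/
def cl (j : ℕ) (u : Fin n → Bool) : ZMod 3 := (SumCodeZero.bw bl j u : ZMod 3)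

/-- the class vector of the first `k` blocks (the CELL of `u`). -/
def cvec (k : ℕ) (u : Fin n → Bool) : Fin k → ZMod 3 := fun j => cl bl j.val u

/-- the LOSE set of a family of patterns `π j : (Fin n → Bool) → Fin 4` (party `j`'s action at `u`),
scored by the table game on the cell of `u`. -/
def loses (k : ℕ) (π : ℕ → (Fin n → Bool) → Fin 4) : Finset (Fin n → Bool) :=
  univ.filter fun u => tabWin (cvec bl k u) (fun j => π j.val u) = false

variable {bl}

/-- the overwrite `ovr bl j u v` agrees with `v` on block `j`. -/
theorem ovr_agree (j : ℕ) (u a : Fin n → Bool) (i : Fin n) (hi : bl i = j) :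
    SumCodeZero.ovr bl j u a i = a i := by
  simp [SumCodeZero.ovr, hi]

/-- the overwrite `ovr bl j u v` agrees with `u` off block `j`. -/
theorem ovr_off (j : ℕ) (u a : Fin n → Bool) (i : Fin n) (hi : bl i ≠ j) :
    SumCodeZero.ovr bl j u a i = u i := by
  simp [SumCodeZero.ovr, hi]

/-- a block-`j`-local function sees only the overwriting pattern on block `j`. -/
theorem BlockLocal.ovr_same {β : Sort*} {j : ℕ} {f : (Fin n → Bool) → β} (hf : BlockLocal bl j f)
    (u a : Fin n → Bool) : f (SumCodeZero.ovr bl j u a) = f a :=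
  hf _ _ fun i hi => ovr_agree j u a i hi

/-- a block-`j`-local function is invariant under overwriting another block. -/
theorem BlockLocal.ovr_ne {β : Sort*} {j j' : ℕ} (hjj : j ≠ j') {f : (Fin n → Bool) → β}
    (hf : BlockLocal bl j' f) (u a : Fin n → Bool) : f (SumCodeZero.ovr bl j u a) = f u :=
  hf _ _ fun i hi => ovr_off j u a i fun h => hjj (h.symm.trans hi)

/-- post-composition preserves block-locality. -/
theorem BlockLocal.comp {β γ : Sort*} {j : ℕ} {f : (Fin n → Bool) → β} (hf : BlockLocal bl j f)
    (g : β → γ) : BlockLocal bl j (fun u => g (f u)) :=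
  fun u v huv => congrArg g (hf u v huv)

/-- the block weight `bw bl j` is block-`j`-local. -/
theorem blockLocal_bw (j : ℕ) : BlockLocal bl j (SumCodeZero.bw bl j) := by
  intro u v huv
  unfold SumCodeZero.bw
  congr 1
  ext i
  simp only [mem_filter, mem_univ, true_and]
  constructor
  · rintro ⟨hi, hu⟩; exact ⟨hi, (huv i hi) ▸ hu⟩
  · rintro ⟨hi, hv⟩; exact ⟨hi, (huv i hi).symm ▸ hv⟩

/-- the own-class `cl bl j` is block-`j`-local. -/
theorem blockLocal_cl (j : ℕ) : BlockLocal bl j (cl bl j) :=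
  (blockLocal_bw j).comp (fun m : ℕ => (m : ZMod 3))

/-- the own-class of block `j` is invariant under overwriting another block. -/
theorem cl_ovr_ne {j j' : ℕ} (hjj : j ≠ j') (u a : Fin n → Bool) :
    cl bl j' (SumCodeZero.ovr bl j u a) = cl bl j' u :=
  (blockLocal_cl j').ovr_ne hjj u a

/-- the classes of this file are the residue classes `SumCodeZero.cls`. -/
theorem card_cl_eq (j : ℕ) (r : ZMod 3) :
    (univ.filter fun u : Fin n → Bool => cl bl j u = r).card = (SumCodeZero.cls bl j r.val).card := by
  unfold cl SumCodeZero.cls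
  congr 1
  ext u
  simp only [mem_filter, mem_univ, true_and]
  constructor
  · intro h; rw [← h, ZMod.val_natCast]
  · intro h; rw [← ZMod.natCast_mod, h, ZMod.natCast_zmod_val]

/-- **Independence count.** If `A` reads only block `j` and `B` does not read block `j`, then
`2ⁿ·#{A ∧ B} = #A · #B` (from the block-swap double count `SumCodeZero.sum_card_filter_ovr`). -/
theorem indep_count (j : ℕ) (A B : (Fin n → Bool) → Prop) [DecidablePred A] [DecidablePred B]
    (hA : ∀ u v : Fin n → Bool, (∀ i, bl i = j → u i = v i) → (A u ↔ A v))
    (hB : ∀ u a, B (SumCodeZero.ovr bl j u a) ↔ B u) :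
    2 ^ n * (univ.filter fun u => A u ∧ B u).card =
      (univ.filter fun u => A u).card * (univ.filter fun u => B u).card := by
  classical
  rw [← SumCodeZero.sum_card_filter_ovr (bl := bl) j (fun u => A u ∧ B u)]
  have hterm : ∀ a : Fin n → Bool, (univ.filter fun u : Fin n → Bool =>
      A (SumCodeZero.ovr bl j u a) ∧ B (SumCodeZero.ovr bl j u a)).card =
      if A a then (univ.filter fun u => B u).card else 0 := by
    intro a
    have hAa : ∀ u, A (SumCodeZero.ovr bl j u a) ↔ A a :=
      fun u => hA _ _ fun i hi => ovr_agree j u a i hi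
    by_cases ha : A a
    · rw [if_pos ha]
      congr 1
      ext u
      simp only [mem_filter, mem_univ, true_and, hAa u, ha, hB u a]
    · rw [if_neg ha, Finset.card_eq_zero, Finset.filter_eq_empty_iff]
      intro u _ h
      exact ha ((hAa u).1 h.1)
  simp_rw [hterm]
  rw [← Finset.sum_filter, Finset.sum_const, smul_eq_mul]

/-- product form of the independence count over the reals. -/
theorem indep_count_real (j : ℕ) (A B : (Fin n → Bool) → Prop) [DecidablePred A] [DecidablePred B]
    (hA : ∀ u v : Fin n → Bool, (∀ i, bl i = j → u i = v i) → (A u ↔ A v))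
    (hB : ∀ u a, B (SumCodeZero.ovr bl j u a) ↔ B u) :
    ((univ.filter fun u => A u ∧ B u).card : ℝ) =
      (univ.filter fun u => A u).card * (univ.filter fun u => B u).card / 2 ^ n := by
  have h := indep_count j A B hA hB
  have h' : ((2 : ℝ) ^ n) * ((univ.filter fun u => A u ∧ B u).card : ℝ) =
      ((univ.filter fun u => A u).card : ℝ) * ((univ.filter fun u => B u).card : ℝ) := by
    exact_mod_cast h
  rw [eq_div_iff (by positivity), mul_comm]
  exact h'

/-- **One derandomisation step.** If every party's pattern reads only its own block, party `j`'s
pattern can be replaced by a CLASS-TABLE `T ∘ cl_j` without increasing the LOSE set (choose, class by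
class, the action against which the others lose least), and the new family is still block-local. -/
theorem derand_step (k : ℕ) (π : ℕ → (Fin n → Bool) → Fin 4) (hπ : ∀ j, BlockLocal bl j (π j))
    (j : ℕ) (hj : j < k) :
    ∃ T : ZMod 3 → Fin 4,
      (loses bl k (Function.update π j (fun u => T (cl bl j u)))).card ≤ (loses bl k π).card ∧
      ∀ j', BlockLocal bl j' (Function.update π j (fun u => T (cl bl j u)) j') := by
  classical
  set J : Fin k := ⟨j, hj⟩ with hJ
  -- the off-block-`j` predicate: party `j`'s class and action frozen to `(r, ρ)`
  set B' : ZMod 3 → Fin 4 → (Fin n → Bool) → Prop := fun r ρ u =>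
    tabWin (Function.update (cvec bl k u) J r) (Function.update (fun i : Fin k => π i.val u) J ρ) = false
    with hB'def
  have hB' : ∀ r ρ u a, B' r ρ (SumCodeZero.ovr bl j u a) ↔ B' r ρ u := by
    intro r ρ u a
    have h1 : Function.update (cvec bl k (SumCodeZero.ovr bl j u a)) J r =
        Function.update (cvec bl k u) J r := by
      funext i
      by_cases hi : i = J
      · subst hi; simp
      · rw [Function.update_of_ne hi, Function.update_of_ne hi]
        have hij : j ≠ i.val := fun h => hi (Fin.ext h.symm)
        exact cl_ovr_ne hij u a
    have h2 : Function.update (fun i : Fin k => π i.val (SumCodeZero.ovr bl j u a)) J ρ =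
        Function.update (fun i : Fin k => π i.val u) J ρ := by
      funext i
      by_cases hi : i = J
      · subst hi; simp
      · rw [Function.update_of_ne hi, Function.update_of_ne hi]
        have hij : j ≠ i.val := fun h => hi (Fin.ext h.symm)
        exact (hπ i.val).ovr_ne hij u a
    simp only [hB'def, h1, h2]
  -- the class tables: class by class, the action against which the others lose least
  have hmin : ∀ r : ZMod 3, ∃ ρ₀ : Fin 4, ∀ ρ : Fin 4,
      (univ.filter fun u => B' r ρ₀ u).card ≤ (univ.filter fun u => B' r ρ u).card := by
    intro r
    obtain ⟨ρ₀, -, h⟩ := exists_min_image univ (fun ρ : Fin 4 => (univ.filter fun u => B' r ρ u).card)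
      univ_nonempty
    exact ⟨ρ₀, fun ρ => h ρ (mem_univ _)⟩
  choose T hT using hmin
  set π' : ℕ → (Fin n → Bool) → Fin 4 := Function.update π j (fun u => T (cl bl j u)) with hπ'def
  refine ⟨T, ?_, ?_⟩
  swap
  · intro j'
    by_cases hj' : j' = j
    · subst hj'
      rw [Function.update_self]
      exact (blockLocal_cl j').comp T
    · rw [Function.update_of_ne hj']
      exact hπ j'
  -- block-`j`-local key predicate
  set A : ZMod 3 → Fin 4 → (Fin n → Bool) → Prop := fun r ρ u => cl bl j u = r ∧ π j u = ρ with hAdef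
  have hA : ∀ r ρ (u v : Fin n → Bool), (∀ i, bl i = j → u i = v i) → (A r ρ u ↔ A r ρ v) := by
    intro r ρ u v huv
    simp only [hAdef, blockLocal_cl j u v huv, hπ j u v huv]
  have hAc : ∀ r (u v : Fin n → Bool), (∀ i, bl i = j → u i = v i) →
      (cl bl j u = r ↔ cl bl j v = r) := by
    intro r u v huv; rw [blockLocal_cl j u v huv]
  -- (E1) the LOSE set of `π`, fibred over party `j`'s (class, action)
  have hE1 : (loses bl k π).card = ∑ r : ZMod 3, ∑ ρ : Fin 4, (univ.filter fun u => A r ρ u ∧ B' r ρ u).card := by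
    rw [card_eq_sum_card_fiberwise (f := fun u => cl bl j u) (t := univ) (fun _ _ => mem_univ _)]
    refine Finset.sum_congr rfl fun r _ => ?_
    rw [card_eq_sum_card_fiberwise (f := fun u => π j u) (t := univ) (fun _ _ => mem_univ _)]
    refine Finset.sum_congr rfl fun ρ _ => ?_
    congr 1
    ext u
    simp only [loses, mem_filter, mem_univ, true_and, hAdef, hB'def]
    constructor
    · rintro ⟨⟨hl, hr⟩, hρ⟩
      refine ⟨⟨hr, hρ⟩, ?_⟩
      have e1 : Function.update (cvec bl k u) J r = cvec bl k u := by
        rw [← hr]; exact Function.update_eq_self J (cvec bl k u)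
      have e2 : Function.update (fun i : Fin k => π i.val u) J ρ = fun i : Fin k => π i.val u := by
        rw [← hρ]; exact Function.update_eq_self J (fun i : Fin k => π i.val u)
      rw [e1, e2]; exact hl
    · rintro ⟨⟨hr, hρ⟩, hb⟩
      have e1 : Function.update (cvec bl k u) J r = cvec bl k u := by
        rw [← hr]; exact Function.update_eq_self J (cvec bl k u)
      have e2 : Function.update (fun i : Fin k => π i.val u) J ρ = fun i : Fin k => π i.val u := by
        rw [← hρ]; exact Function.update_eq_self J (fun i : Fin k => π i.val u)
      rw [e1, e2] at hb
      exact ⟨⟨hb, hr⟩, hρ⟩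
  -- (E3) party `j`'s (class, action) fibres of a class
  have hE3 : ∀ r : ZMod 3, ∑ ρ : Fin 4, (univ.filter fun u => A r ρ u).card =
      (univ.filter fun u => cl bl j u = r).card := by
    intro r
    rw [card_eq_sum_card_fiberwise (f := fun u => π j u) (s := univ.filter fun u => cl bl j u = r)
      (t := univ) (fun _ _ => mem_univ _)]
    refine Finset.sum_congr rfl fun ρ _ => ?_
    congr 1; ext u; simp [hAdef]
  -- (E5) the LOSE set of `π'`, fibred over party `j`'s class
  have hE5 : (loses bl k π').card = ∑ r : ZMod 3, (univ.filter fun u => cl bl j u = r ∧ B' r (T r) u).card := by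
    rw [card_eq_sum_card_fiberwise (f := fun u => cl bl j u) (t := univ) (fun _ _ => mem_univ _)]
    refine Finset.sum_congr rfl fun r _ => ?_
    congr 1
    ext u
    simp only [loses, mem_filter, mem_univ, true_and, hB'def]
    have e2 : (fun i : Fin k => π' i.val u) = Function.update (fun i : Fin k => π i.val u) J (T (cl bl j u)) := by
      funext i
      by_cases hi : i = J
      · subst hi
        rw [Function.update_self]
        show Function.update π j (fun u => T (cl bl j u)) j u = _
        rw [Function.update_self]
      · have hij : i.val ≠ j := fun h => hi (Fin.ext h)
        rw [Function.update_of_ne hi]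
        show Function.update π j (fun u => T (cl bl j u)) i.val u = _
        rw [Function.update_of_ne hij]
    constructor
    · rintro ⟨hl, hr⟩
      refine ⟨hr, ?_⟩
      have e1 : Function.update (cvec bl k u) J r = cvec bl k u := by
        rw [← hr]; exact Function.update_eq_self J (cvec bl k u)
      rw [e1, ← hr]
      show tabWin (cvec bl k u) (Function.update (fun i : Fin k => π i.val u) J (T (cl bl j u))) = false
      rw [← e2]; exact hl
    · rintro ⟨hr, hb⟩
      refine ⟨?_, hr⟩
      have e1 : Function.update (cvec bl k u) J r = cvec bl k u := by
        rw [← hr]; exact Function.update_eq_self J (cvec bl k u)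
      rw [e1, ← hr] at hb
      rw [e2]; exact hb
  -- the chain
  have hpos : 0 < 2 ^ n := Nat.two_pow_pos n
  refine Nat.le_of_mul_le_mul_left ?_ hpos
  calc 2 ^ n * (loses bl k π').card
      = ∑ r : ZMod 3, 2 ^ n * (univ.filter fun u => cl bl j u = r ∧ B' r (T r) u).card := by
        rw [hE5, mul_sum]
    _ = ∑ r : ZMod 3, (univ.filter fun u => cl bl j u = r).card * (univ.filter fun u => B' r (T r) u).card := by
        refine Finset.sum_congr rfl fun r _ => ?_
        exact indep_count j (fun u => cl bl j u = r) (B' r (T r)) (hAc r) (hB' r (T r))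
    _ = ∑ r : ZMod 3, ∑ ρ : Fin 4, (univ.filter fun u => A r ρ u).card * (univ.filter fun u => B' r (T r) u).card := by
        refine Finset.sum_congr rfl fun r _ => ?_
        rw [← hE3 r, sum_mul]
    _ ≤ ∑ r : ZMod 3, ∑ ρ : Fin 4, (univ.filter fun u => A r ρ u).card * (univ.filter fun u => B' r ρ u).card := by
        refine Finset.sum_le_sum fun r _ => Finset.sum_le_sum fun ρ _ => ?_
        exact Nat.mul_le_mul_left _ (hT r ρ)
    _ = ∑ r : ZMod 3, ∑ ρ : Fin 4, 2 ^ n * (univ.filter fun u => A r ρ u ∧ B' r ρ u).card := by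
        refine Finset.sum_congr rfl fun r _ => Finset.sum_congr rfl fun ρ _ => ?_
        exact (indep_count j (A r ρ) (B' r ρ) (hA r ρ) (hB' r ρ)).symm
    _ = 2 ^ n * (loses bl k π).card := by
        rw [hE1, mul_sum]
        refine Finset.sum_congr rfl fun r _ => ?_
        rw [mul_sum]
end Bridge

end Summit.QuantumAdvantage.QuantumAdvantage.Theorems.PartyDial
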